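import Literature.Analysis.FluidPDE.GKPCriticalElements
import Literature.Analysis.FluidPDE.CriticalRegularityScaling
import Literature.Analysis.FluidPDE.KatoLocalCovariance
import Literature.Analysis.FunctionSpaces.LittlewoodPaleyProofs
import HarnessLib

/-!
# Scale covariance of Besov mild solutions, of the maximal time and of GKP's critical elements

Analysis/FluidPDE support file (theorems only, no definitions, no named facts) for the family
`CriticalRegularity.lean` / `GKPCriticalElements.lean`. Gallagher–Koch–Planchon 2016 use
throughout §2 that the Navier–Stokes scaling
`Λ_{j,n} U(x, t) = λ⁻¹ U(λ⁻¹(x - x_{j,n}), λ⁻² t)` ((2.1), arXiv:1407.4156 p. 6) maps solutions to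
solutions with `NS(Λ φ) = Λ NS(φ)`, multiplies the maximal time by `λ²` ((2.5): the blow-up times
of the rescaled profiles are `λ²_{j,n} T*_j`) and leaves the critical norm `‖·‖_{Ḃ^{s_p}_{p,p}}`
invariant (§1.1: "`‖u_{0,λ}‖_X ≡ ‖u₀‖_X` … where `u_{0,λ}(x) := λ u₀(λx)` … evolves as
`u_λ(t,x) := λ u(λ²t, λx)`"; used in §2.3: "`‖(Λ_{1,n}U₁)(t_n)‖ = ‖U₁(s)‖`", `t_n = λ²_{1,n} s`).
This file proves these three facts for the tree's renderings — the class
`IsBesovMildSolutionOn`, the structural maximal time `IsMaximalBesovMildSolution`, and GKP's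
critical elements `IsCriticalElement` — for the scalings `u ↦ rescale c u`,
`(rescale c u)(t, x) = c u(c² t, c x)` (`CriticalSpaces.lean`; `c = λ⁻¹… = λ` in GKP's notation
with `λ = c`), paired on the distribution side with `U ↦ rescaleDistrib c (U (c² ·))`:

* `MemKatoClassOn.rescale` (any `c > 0`): Kato's class `K_∞` is scale invariant
  (`√t · c ‖u(c²t)‖_∞ = √(c²t) ‖u(c²t)‖_∞`);
* `isMildNSSolutionOn_Ico_rescale`, `aestronglyMeasurable_uncurry_rescale_Ioo`,
  `isDistributionOf_rescale` (any `c > 0`): the duality-form mild identity from `t = 0`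
  (`Fluid.IsMildNSSolutionBetween.nsRescale_zero`), space–time measurability and the passage to
  distributions (`IsDistributionOf.rescaleData`) are covariant;
* `ContinuousInHomBesovOn.rescale_two_zpow` (dyadic `c = 2^{j₀}`): continuity in the critical
  space `Ḃ^{-1+3/p}_{p,q}` is covariant — the homogeneous Besov norm of `LittlewoodPaley.lean` is
  *exactly* invariant under the critical rescaling for dyadic scales
  (`eHomBesovNorm_rescaleData` with `eHomBesovNorm_distribDilate_holds`, BCD Prop. 2.18; for
  non-dyadic `c` only up to constants, BCD Rem. 2.19, which is why the assembled statements below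
  are dyadic);
* `IsBesovMildSolutionOn.rescale_two_zpow`: a Besov mild solution on `[0, T)` in the class
  `(s_p, p, q)` rescales to one on `[0, T/c²)`, `c = 2^{j₀}`;
* `IsMaximalBesovMildSolution.rescale_two_zpow`: so does a maximal one (an extension of the
  rescaled solution would rescale back, by `c⁻¹ = 2^{-j₀}`, to an extension of the original; the
  a.e. agreement of slices is transported along the dilation `x ↦ c⁻¹ x`, which is
  quasi-measure-preserving) — GKP's "`T*(Λφ) = λ² T*(φ)`";
* `biSup_eHomBesovNorm_rescale_two_zpow`, `IsCriticalElement.rescale_two_zpow`: the supremum of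
  the critical norm over the lifespan is invariant, hence `𝒟_c` is invariant under the dyadic
  scalings (GKP §2.3).

Space translations `x ↦ x - x₀` (the cores `x_{j,n}` of (2.1)) are not treated here.

## References

* I. Gallagher, G. S. Koch, F. Planchon, *Blow-up of critical Besov norms at a potential
  Navier–Stokes singularity*, Comm. Math. Phys. 343 (2016) 39–82 = arXiv:1407.4156, §1.1
  (scaling), (2.1), (2.5), §2.3. [cite: GKP2016, §1.1 and (2.1), (2.5)]
* H. Bahouri, J.-Y. Chemin, R. Danchin, *Fourier Analysis and Nonlinear PDE* (2011), Prop. 2.18,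
  Rem. 2.19. [cite: BahouriCheminDanchin2011, Prop. 2.18]
-/

noncomputable section

open MeasureTheory TemperedDistribution Set Function Filter Topology
open scoped SchwartzMap ENNReal NNReal

namespace Literature.Analysis.FluidPDE

/-! ## Elementary reindexing along the parabolic time dilation `t ↦ c² t` -/

section Reindex

/-- The parabolic time dilation `t ↦ c² t`, `c ≠ 0`, maps `[0, T/c²)` into `[0, T)`.
[folklore] -/
theorem mapsTo_sq_mul_Ico_div {c : ℝ} (hc : c ≠ 0) (T : ℝ) :
    MapsTo (fun t => c ^ 2 * t) (Ico 0 (T / c ^ 2)) (Ico 0 T) := fun t ht => by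
  have hc2 : 0 < c ^ 2 := by positivity
  refine ⟨mul_nonneg hc2.le ht.1, ?_⟩
  show c ^ 2 * t < T
  rw [mul_comm]
  exact (lt_div_iff₀ hc2).1 ht.2

/-- The inverse parabolic time dilation `t ↦ t / c²`, `c ≠ 0`, maps `[0, T)` into `[0, T/c²)`.
[folklore] -/
theorem mapsTo_div_sq_Ico_div {c : ℝ} (hc : c ≠ 0) (T : ℝ) :
    MapsTo (fun t => t / c ^ 2) (Ico 0 T) (Ico 0 (T / c ^ 2)) := fun _ ht =>
  have hc2 : 0 < c ^ 2 := by positivity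
  ⟨div_nonneg ht.1 hc2.le, div_lt_div_of_pos_right ht.2 hc2⟩

/-- Reindexing a supremum over `[0, T/c²)` along the parabolic time dilation `t ↦ c² t`,
`c ≠ 0`: `sup_{t ∈ [0,T/c²)} F(c² t) = sup_{t ∈ [0,T)} F(t)`. [folklore] -/
theorem biSup_Ico_comp_sq_mul {α : Type*} [CompleteLattice α] (F : ℝ → α) {c : ℝ}
    (hc : c ≠ 0) (T : ℝ) :
    ⨆ t ∈ Ico 0 (T / c ^ 2), F (c ^ 2 * t) = ⨆ t ∈ Ico 0 T, F t := by
  apply le_antisymm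
  · exact iSup₂_le fun t ht => le_iSup₂_of_le (c ^ 2 * t) (mapsTo_sq_mul_Ico_div hc T ht) le_rfl
  · refine iSup₂_le fun t ht => le_iSup₂_of_le (t / c ^ 2) (mapsTo_div_sq_Ico_div hc T ht) ?_
    rw [mul_div_cancel₀ t (pow_ne_zero 2 hc)]

end Reindex

/-! ## The scale-invariant clauses of the class (any `c > 0`) -/

section AnyScale

variable {ι : Type*} [Fintype ι]

/-- The `L^∞` norm of a rescaled slice: `‖c u(c²t)(c ·)‖_∞ = c ‖u(c²t)‖_∞` for `c > 0`
(dilation invariance of `L^∞`, `eLpNorm_top_comp_smul`). [folklore] -/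
theorem eLpNorm_top_rescale_apply (u : ℝ → EuclideanSpace ℝ ι → EuclideanSpace ℝ ι) {c : ℝ}
    (hc : 0 < c) (t : ℝ) :
    eLpNorm (FluidPDE.rescale c u t) ∞ volume =
      ENNReal.ofReal c * eLpNorm (u (c ^ 2 * t)) ∞ volume := by
  have h1 : FluidPDE.rescale c u t = c • fun x => u (c ^ 2 * t) (c • x) := by
    funext x
    simp [rescale_apply]
  rw [h1, eLpNorm_const_smul, eLpNorm_top_comp_smul (u (c ^ 2 * t)) hc.ne',
    Real.enorm_eq_ofReal hc.le]

/-- Kato's weight of a rescaled field: `√t ‖(rescale c u)(t)‖_∞ = √(c²t) ‖u(c²t)‖_∞`, `c > 0`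
(for all real `t`: `√(c² t) = c √t` with Mathlib's `√` vanishing on the negatives). [folklore] -/
theorem sqrt_mul_eLpNorm_rescale (u : ℝ → EuclideanSpace ℝ ι → EuclideanSpace ℝ ι) {c : ℝ}
    (hc : 0 < c) (t : ℝ) :
    ENNReal.ofReal (Real.sqrt t) * eLpNorm (FluidPDE.rescale c u t) ∞ volume =
      ENNReal.ofReal (Real.sqrt (c ^ 2 * t)) * eLpNorm (u (c ^ 2 * t)) ∞ volume := by
  rw [eLpNorm_top_rescale_apply u hc, ← mul_assoc, ← ENNReal.ofReal_mul (Real.sqrt_nonneg t),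
    Real.sqrt_mul (sq_nonneg c), Real.sqrt_sq hc.le, mul_comm (Real.sqrt t) c]

/-- **Kato's class `K_∞` is scale invariant**: if `sup_{0<τ<t} √τ ‖u(τ)‖_∞ < ∞` for `t < T` and
`√t ‖u(t)‖_∞ → 0` at `0⁺`, then the same holds for `rescale c u` on `[0, T/c²)`, `c > 0`
(`√t · c ‖u(c²t)‖_∞ = √(c²t) ‖u(c²t)‖_∞` and `t ↦ c²t` maps `(0, t)` onto `(0, c²t)`;
Koch–Tataru 2001, §1; GKP 2016, §1.1). [cite: GKP2016, §1.1] -/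
theorem MemKatoClassOn.rescale {T : ℝ} {u : ℝ → EuclideanSpace ℝ ι → EuclideanSpace ℝ ι}
    (h : MemKatoClassOn T u) {c : ℝ} (hc : 0 < c) :
    MemKatoClassOn (T / c ^ 2) (FluidPDE.rescale c u) := by
  have hc2 : 0 < c ^ 2 := pow_pos hc 2
  refine ⟨fun t ht => ?_, ?_⟩
  · have ht' : c ^ 2 * t < T := by rwa [lt_div_iff₀ hc2, mul_comm] at ht
    refine lt_of_le_of_lt (iSup₂_le fun τ hτ => ?_) (h.1 (c ^ 2 * t) ht')
    rw [sqrt_mul_eLpNorm_rescale u hc τ]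
    exact le_iSup₂_of_le (f := fun (τ : ℝ) (_ : τ ∈ Ioo 0 (c ^ 2 * t)) =>
        ENNReal.ofReal (Real.sqrt τ) * eLpNorm (u τ) ∞ volume) (c ^ 2 * τ)
      ⟨mul_pos hc2 hτ.1, mul_lt_mul_of_pos_left hτ.2 hc2⟩ le_rfl
  · have hw : (fun τ => ENNReal.ofReal (Real.sqrt τ) *
          eLpNorm (FluidPDE.rescale c u τ) ∞ volume) =
        (fun τ => ENNReal.ofReal (Real.sqrt τ) * eLpNorm (u τ) ∞ volume) ∘
          fun τ => c ^ 2 * τ :=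
      funext fun τ => sqrt_mul_eLpNorm_rescale u hc τ
    -- `τ ↦ c² τ` tends to `0⁺` within `(0, ∞)` as `τ → 0⁺`
    have hφ : Tendsto (fun τ : ℝ => c ^ 2 * τ) (𝓝[>] 0) (𝓝[>] 0) := by
      refine tendsto_nhdsWithin_of_tendsto_nhds_of_eventually_within _ ?_ ?_
      · simpa only [mul_zero] using
          ((continuous_const_mul (c ^ 2)).tendsto (0 : ℝ)).mono_left nhdsWithin_le_nhds
      · exact eventually_nhdsWithin_of_forall fun τ hτ => mul_pos hc2 hτ
    rw [hw]
    exact h.2.comp hφ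

/-- **The duality-form mild identity from `t = 0` is scale covariant**: a mild solution on
`[0, T)` from its own initial slice rescales to a mild solution on `[0, T/c²)` from its own
initial slice, `c > 0` (weak divergence-freeness: `Fluid.IsWeaklyDivFree.nsRescaleData`; the
identity: `Fluid.IsMildNSSolutionBetween.nsRescale_zero`; GKP 2016, §1.1: `u_λ` solves (NS) with
datum `u_{0,λ}`). [cite: GKP2016, §1.1] -/
theorem isMildNSSolutionOn_Ico_rescale {ν T : ℝ}
    {u : ℝ → EuclideanSpace ℝ ι → EuclideanSpace ℝ ι}
    (h : FluidPDE.IsMildNSSolutionOn (Ico 0 T) ν 0 (u 0) u) {c : ℝ} (hc : 0 < c) :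
    FluidPDE.IsMildNSSolutionOn (Ico 0 (T / c ^ 2)) ν 0 (FluidPDE.rescale c u 0)
      (FluidPDE.rescale c u) := by
  have hS := mapsTo_sq_mul_Ico_div hc.ne' T
  refine ⟨fun t ht => (h.1 (c ^ 2 * t) (hS ht)).nsRescaleData hc, fun t ht => ?_⟩
  have h2 : FluidPDE.IsMildNSSolutionBetween ν 0 u (c ^ 2 * 0) (c ^ 2 * t) := by
    rw [mul_zero, ← FluidPDE.isMildNSSolutionFrom_self_iff]
    exact h.2 (c ^ 2 * t) (hS ht)
  exact FluidPDE.isMildNSSolutionFrom_self_iff.2 (IsMildNSSolutionBetween.nsRescale_zero hc h2)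

variable {E : Type*} [NormedAddCommGroup E] [InnerProductSpace ℝ E] [FiniteDimensional ℝ E]
  [MeasurableSpace E] [BorelSpace E]

/-- **Space–time measurability is scale covariant**: measurability of `u` on the strip
`(0, T) × E` gives measurability of `rescale c u` on `(0, T/c²) × E`, `c > 0` (the parabolic
dilation `(s, y) ↦ (c² s, c y)` is a quasi-measure-preserving bijection between the strips,
`Fluid.aestronglyMeasurable_comp_stAffine_Ioo`). [folklore] -/
theorem aestronglyMeasurable_uncurry_rescale_Ioo {T : ℝ} {u : ℝ → E → E}
    (h : AEStronglyMeasurable (uncurry u) (volume.restrict (Ioo 0 T ×ˢ univ))) {c : ℝ}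
    (hc : 0 < c) :
    AEStronglyMeasurable (uncurry (FluidPDE.rescale c u))
      (volume.restrict (Ioo 0 (T / c ^ 2) ×ˢ univ)) := by
  have h1 : uncurry (FluidPDE.rescale c u) =
      fun z => c • (uncurry u ∘ FluidPDE.stAffine (c ^ 2) c 0 (0 : E)) z := by
    funext ⟨s, y⟩
    simp [rescale_apply, FluidPDE.stAffine]
  rw [h1]
  exact (FluidPDE.aestronglyMeasurable_comp_stAffine_Ioo (pow_pos hc 2) hc (0 : E) h).const_smul c

/-- **The passage to distributions is scale covariant**: if `U t` is the distribution of the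
slice `u t` for `t ∈ [0, T)`, then `rescaleDistrib c (U (c²t)) = c • (U(c²t))(c ·)` is the
distribution of the slice `(rescale c u) t = c u(c²t)(c ·)` for `t ∈ [0, T/c²)`, `c > 0`
(`IsDistributionOf.rescaleData`, BCD §1.2.1). [cite: BahouriCheminDanchin2011, §1.2.1] -/
theorem isDistributionOf_rescale {T : ℝ}
    {u : ℝ → EuclideanSpace ℝ (Fin 3) → EuclideanSpace ℝ (Fin 3)}
    {U : ℝ → 𝓢'(EuclideanSpace ℝ (Fin 3), EuclideanSpace ℂ (Fin 3))}
    (h : ∀ t ∈ Ico 0 T, IsDistributionOf (u t) (U t)) {c : ℝ} (hc : 0 < c)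
    {t : ℝ} (ht : t ∈ Ico 0 (T / c ^ 2)) :
    IsDistributionOf (FluidPDE.rescale c u t)
      (rescaleDistrib (Units.mk0 c hc.ne') (U (c ^ 2 * t))) :=
  (h (c ^ 2 * t) (mapsTo_sq_mul_Ico_div hc.ne' T ht)).rescaleData (Units.mk0 c hc.ne')

end AnyScale

/-! ## Dyadic scalings: Besov continuity, the class, the maximal time, the critical elements -/

section Dyadic

variable {p q : ℝ≥0∞} [Fact (1 ≤ p)]

/-- **Continuity in the critical Besov space is covariant under dyadic scalings**: if
`U ∈ C(S; Ḃ^{-1+3/p}_{p,q})` then `t ↦ rescaleDistrib 2^{j₀} (U (4^{j₀} t))` is continuous in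
`Ḃ^{-1+3/p}_{p,q}` on every `S'` mapped into `S` by `t ↦ 4^{j₀} t`: the critical norm is exactly
invariant under the dyadic rescalings (`eHomBesovNorm_rescaleData` with
`eHomBesovNorm_distribDilate_holds`, BCD Prop. 2.18; GKP 2016, §1.1 "`‖u_{0,λ}‖_X ≡ ‖u₀‖_X`"),
and `rescaleDistrib` is linear. [cite: GKP2016, §1.1] -/
theorem ContinuousInHomBesovOn.rescale_two_zpow {S S' : Set ℝ}
    {U : ℝ → 𝓢'(EuclideanSpace ℝ (Fin 3), EuclideanSpace ℂ (Fin 3))}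
    (h : ContinuousInHomBesovOn S (-1 + 3 / p.toReal) p q U) (j₀ : ℤ)
    (hS : MapsTo (fun t => ((2 : ℝ) ^ j₀) ^ 2 * t) S' S) :
    ContinuousInHomBesovOn S' (-1 + 3 / p.toReal) p q fun t =>
      rescaleDistrib (Units.mk0 ((2 : ℝ) ^ j₀) (zpow_ne_zero j₀ two_ne_zero))
        (U (((2 : ℝ) ^ j₀) ^ 2 * t)) := by
  refine ⟨fun t ht => memHomBesov_rescaleData FunctionSpaces.MemHomBesov.distribDilate_holds
    (h.1 _ (hS ht)) j₀, fun t₀ ht₀ => ?_⟩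
  have key : ∀ t, FunctionSpaces.eHomBesovNorm (-1 + 3 / p.toReal) p q
      (rescaleDistrib (Units.mk0 ((2 : ℝ) ^ j₀) (zpow_ne_zero j₀ two_ne_zero))
          (U (((2 : ℝ) ^ j₀) ^ 2 * t)) -
        rescaleDistrib (Units.mk0 ((2 : ℝ) ^ j₀) (zpow_ne_zero j₀ two_ne_zero))
          (U (((2 : ℝ) ^ j₀) ^ 2 * t₀))) =
      FunctionSpaces.eHomBesovNorm (-1 + 3 / p.toReal) p q
        (U (((2 : ℝ) ^ j₀) ^ 2 * t) - U (((2 : ℝ) ^ j₀) ^ 2 * t₀)) := fun t => by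
    rw [← map_sub, eHomBesovNorm_rescaleData FunctionSpaces.eHomBesovNorm_distribDilate_holds]
  simp_rw [key]
  have hφ : Tendsto (fun t : ℝ => ((2 : ℝ) ^ j₀) ^ 2 * t) (𝓝[S'] t₀)
      (𝓝[S] (((2 : ℝ) ^ j₀) ^ 2 * t₀)) :=
    (continuous_const_mul (((2 : ℝ) ^ j₀) ^ 2)).continuousWithinAt.tendsto_nhdsWithin hS
  exact (h.2 _ (hS ht₀)).comp hφ

variable {T ν : ℝ} {u : ℝ → EuclideanSpace ℝ (Fin 3) → EuclideanSpace ℝ (Fin 3)}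
  {U : ℝ → 𝓢'(EuclideanSpace ℝ (Fin 3), EuclideanSpace ℂ (Fin 3))}

/-- **Besov mild solutions are covariant under the dyadic Navier–Stokes scalings**: if `(u, U)`
is a Besov mild solution on `[0, T)` in the class `(s_p, p, q)`, then
`(rescale c u, rescaleDistrib c (U (c² ·)))`, `c = 2^{j₀}`, is a Besov mild solution on
`[0, T/c²)` in the same class (GKP 2016, §1.1: "`u_{0,λ}(x) := λ u₀(λ x)` is the initial datum
which evolves as `u_λ(t,x) := λ u(λ²t, λx)`"; §2.2, (2.1)). The five clauses of the class are
`isMildNSSolutionOn_Ico_rescale`, `aestronglyMeasurable_uncurry_rescale_Ioo`,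
`isDistributionOf_rescale`, `ContinuousInHomBesovOn.rescale_two_zpow`,
`MemKatoClassOn.rescale`. [cite: GKP2016, §1.1 and (2.1)] -/
theorem IsBesovMildSolutionOn.rescale_two_zpow
    (h : IsBesovMildSolutionOn (-1 + 3 / p.toReal) p q T ν u U) (j₀ : ℤ) :
    IsBesovMildSolutionOn (-1 + 3 / p.toReal) p q (T / ((2 : ℝ) ^ j₀) ^ 2) ν
      (rescale ((2 : ℝ) ^ j₀) u) fun t =>
        rescaleDistrib (Units.mk0 ((2 : ℝ) ^ j₀) (zpow_ne_zero j₀ two_ne_zero))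
          (U (((2 : ℝ) ^ j₀) ^ 2 * t)) := by
  have hc : (0 : ℝ) < (2 : ℝ) ^ j₀ := zpow_pos two_pos j₀
  exact
    { mild := isMildNSSolutionOn_Ico_rescale h.mild hc
      aestronglyMeasurable := aestronglyMeasurable_uncurry_rescale_Ioo h.aestronglyMeasurable hc
      isDistributionOf := fun t ht => isDistributionOf_rescale h.isDistributionOf hc ht
      continuousInHomBesovOn := h.continuousInHomBesovOn.rescale_two_zpow j₀
        (mapsTo_sq_mul_Ico_div hc.ne' T)
      memKatoClassOn := h.memKatoClassOn.rescale hc }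

/-- Rescaling by `c⁻¹` undoes rescaling by `c` on the slices, a.e.: if `v s = (rescale c u) s`
a.e. with `s = t/c²`, then `(rescale c⁻¹ v) t = u t` a.e. (`c ≠ 0`; the a.e. agreement is
transported along the quasi-measure-preserving dilation `x ↦ c⁻¹ x`). [folklore] -/
theorem rescale_inv_ae_eq_of_ae_eq_rescale {c : ℝ} (hc : c ≠ 0)
    {v : ℝ → EuclideanSpace ℝ (Fin 3) → EuclideanSpace ℝ (Fin 3)} {t : ℝ}
    (hv : v (t / c ^ 2) =ᵐ[volume] rescale c u (t / c ^ 2)) :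
    rescale c⁻¹ v t =ᵐ[volume] u t := by
  -- the dilation `x ↦ c⁻¹ x` is quasi-measure-preserving (`Measure.map_addHaar_smul`)
  have hq : Measure.QuasiMeasurePreserving (fun x : EuclideanSpace ℝ (Fin 3) => c⁻¹ • x)
      volume volume := by
    refine ⟨measurable_const_smul _, ?_⟩
    rw [Measure.map_addHaar_smul volume (inv_ne_zero hc)]
    exact Measure.smul_absolutelyContinuous
  have h1 := hq.ae_eq_comp hv
  filter_upwards [h1] with x hx
  simp only [Function.comp_apply, rescale_apply, smul_smul, mul_inv_cancel₀ hc, one_smul] at hx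
  have hct : c ^ 2 * (t / c ^ 2) = t := mul_div_cancel₀ t (pow_ne_zero 2 hc)
  rw [hct] at hx
  rw [rescale_apply, show c⁻¹ ^ 2 * t = t / c ^ 2 by rw [inv_pow, div_eq_inv_mul], hx,
    smul_smul, inv_mul_cancel₀ hc, one_smul]

/-- **The maximal time is covariant under the dyadic scalings** (GKP 2016, (2.5): the rescaled
profiles `Λ_{j,n} U_j` blow up at `λ²_{j,n} T*_j`): if `(u, U)` is a *maximal* Besov mild
solution on `[0, T)`, `0 < T`, in the class `(s_p, p, q)`, then its dyadic rescaling by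
`c = 2^{j₀}` is maximal on `[0, T/c²)`. An extension of the rescaled solution to `[0, T')`,
`T' > T/c²`, would rescale by `c⁻¹ = 2^{-j₀}` (`IsBesovMildSolutionOn.rescale_two_zpow`) to a
Besov mild solution on `[0, c² T')`, `c² T' > T`, agreeing a.e. with `u` on `[0, T)`
(`rescale_inv_ae_eq_of_ae_eq_rescale`), contradicting maximality. [cite: GKP2016, (2.5)] -/
theorem IsMaximalBesovMildSolution.rescale_two_zpow
    (h : IsMaximalBesovMildSolution (-1 + 3 / p.toReal) p q T ν u U) (j₀ : ℤ) :
    IsMaximalBesovMildSolution (-1 + 3 / p.toReal) p q (T / ((2 : ℝ) ^ j₀) ^ 2) ν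
      (rescale ((2 : ℝ) ^ j₀) u) fun t =>
        rescaleDistrib (Units.mk0 ((2 : ℝ) ^ j₀) (zpow_ne_zero j₀ two_ne_zero))
          (U (((2 : ℝ) ^ j₀) ^ 2 * t)) := by
  set c : ℝ := (2 : ℝ) ^ j₀ with hcdef
  have hc : 0 < c := zpow_pos two_pos j₀
  have hc2 : 0 < c ^ 2 := pow_pos hc 2
  have hinv : (2 : ℝ) ^ (-j₀) = c⁻¹ := zpow_neg (2 : ℝ) j₀
  refine ⟨h.isBesovMildSolutionOn.rescale_two_zpow j₀, ?_⟩
  rintro ⟨T', hT', v, V, hv, hvu⟩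
  have hv' := hv.rescale_two_zpow (-j₀)
  have hT'' : T < T' / ((2 : ℝ) ^ (-j₀)) ^ 2 := by
    rw [hinv, inv_pow, div_inv_eq_mul]
    rwa [gt_iff_lt, div_lt_iff₀ hc2] at hT'
  refine h.not_extendable ⟨_, hT'', _, _, hv', fun t ht => ?_⟩
  have hs : t / c ^ 2 ∈ Ico 0 (T / c ^ 2) := mapsTo_div_sq_Ico_div hc.ne' T ht
  rw [hinv]
  exact rescale_inv_ae_eq_of_ae_eq_rescale hc.ne' (hvu (t / c ^ 2) hs)

/-- **The supremum of the critical norm over the lifespan is invariant under the dyadic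
scalings**:
`sup_{t ∈ [0,T/c²)} ‖rescaleDistrib c (U(c²t))‖_{Ḃ^{-1+3/p}_{p,q}} = sup_{t ∈ [0,T)} ‖U t‖`,
`c = 2^{j₀}` (exact invariance of the critical norm, `eHomBesovNorm_rescaleData`, and reindexing
along `t ↦ c² t`; GKP 2016, §2.3: "`‖(Λ_{1,n}U₁)(t_n)‖ = ‖U₁(s)‖`", `t_n = λ²_{1,n} s`).
[cite: GKP2016, §2.3] -/
theorem biSup_eHomBesovNorm_rescale_two_zpow (p q : ℝ≥0∞) [Fact (1 ≤ p)] (j₀ : ℤ)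
    (U : ℝ → 𝓢'(EuclideanSpace ℝ (Fin 3), EuclideanSpace ℂ (Fin 3))) (T : ℝ) :
    ⨆ t ∈ Ico 0 (T / ((2 : ℝ) ^ j₀) ^ 2), FunctionSpaces.eHomBesovNorm (-1 + 3 / p.toReal) p q
        (rescaleDistrib (Units.mk0 ((2 : ℝ) ^ j₀) (zpow_ne_zero j₀ two_ne_zero))
          (U (((2 : ℝ) ^ j₀) ^ 2 * t))) =
      ⨆ t ∈ Ico 0 T, FunctionSpaces.eHomBesovNorm (-1 + 3 / p.toReal) p q (U t) := by
  simp_rw [eHomBesovNorm_rescaleData FunctionSpaces.eHomBesovNorm_distribDilate_holds]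
  exact biSup_Ico_comp_sq_mul
    (fun t => FunctionSpaces.eHomBesovNorm (-1 + 3 / p.toReal) p q (U t))
    (zpow_ne_zero j₀ two_ne_zero) T

/-- **`𝒟_c` is invariant under the dyadic scalings** (GKP 2016, §2.3 with (2.1), (2.5): the
critical element is found as a rescaled profile, and rescaled critical elements are critical
elements): if `(u, U)` is a critical element with lifespan `T`, then its dyadic rescaling by
`c = 2^{j₀}` is a critical element with lifespan `T/c²` — maximality is covariant
(`IsMaximalBesovMildSolution.rescale_two_zpow`) and the supremum of the critical norm is
invariant (`biSup_eHomBesovNorm_rescale_two_zpow`). [cite: GKP2016, §2.3] -/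
theorem IsCriticalElement.rescale_two_zpow (h : IsCriticalElement ν p T u U) (j₀ : ℤ) :
    IsCriticalElement ν p (T / ((2 : ℝ) ^ j₀) ^ 2) (rescale ((2 : ℝ) ^ j₀) u) fun t =>
      rescaleDistrib (Units.mk0 ((2 : ℝ) ^ j₀) (zpow_ne_zero j₀ two_ne_zero))
        (U (((2 : ℝ) ^ j₀) ^ 2 * t)) where
  pos := div_pos h.pos (pow_pos (zpow_pos two_pos j₀) 2)
  isMaximal := h.isMaximal.rescale_two_zpow j₀
  biSup_eq := by rw [biSup_eHomBesovNorm_rescale_two_zpow, h.biSup_eq]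
  threshold_lt_top := h.threshold_lt_top

end Dyadic

end Literature.Analysis.FluidPDE
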